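import Summits.BirchSwinnertonDyer.Rank1Residual.GaloisImage.KolyvaginDerivativeInvariantModuloUnramified
import Summits.BirchSwinnertonDyer.Rank1Residual.GaloisImage.KolyvaginDerivativeUnramifiedDescent
import Summits.BirchSwinnertonDyer.Rank1Residual.GaloisImage.KolyvaginDerivativeLocalImage
import Literature.NumberTheory.GaloisRepresentations.DecompositionGroupOfCompletion
import HarnessLib

/-!
# THEOREM B-u — Kolyvagin's derivative class at a place `w ∤ p`, `w ∉ r` is, on the decomposition
# group and up to ONE coboundary, an inertia-trivial cocycle with values in `red(T^{I_w})`, for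
# EVERY Euler system unramified above `w` and with NO condition on the Kolyvagin primes
# (cell `bsd-addord`, seat w2-c3 gen 5; route W2 `KimAtThreeKolyvagin`, crux 19076 `DeepUpperAtThree`,
# §U child 19560 `KatoKuriharaPortThreeShared`, residual (C3) = the ANOMALOUS bad places)

HONEST FRAMING: a TOOL theorem of continuous Galois cohomology (curve-free, `p`-free, any number
field `K`, any Euler-system levels `L`); no definition, no named fact, no `sorry`; closes nothing by
itself; nothing is booked; BSD is not proved by any of this.  PROVENANCE: this is file U5 of the
b2b cell's row T-DER-BU (team n1011, seat p15 GEN 27, 2026-08-22), drafted there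
(`run/shared/lean/b2b/bsd-rank1-residual/b2b-bsdres-n1011-p15/g27/KolyvaginDerivativeLocalImageUnramified.draft.lean`,
sha16 870f44cb1369a126) on top of its landed siblings U1–U4 (`GaloisImage/KolyvaginDerivativeInvariantModulo`,
`…UnramifiedDescent`, `…InvariantModuloUnramified`, `…UnramifiedLift`) and banked UNFILED when that
cell parked; it is landed here verbatim (namespace of this file) because it is the kernel form of the
(C3) residual of crux 19560 identified by w2-c3 gen 4 (memo `HOME/w2c3/W2C3-C3-LOCAL-ANALYSIS-g4.md`
§3, "D7-u") and by the planner (STATUS 18:05Z / 18:25Z).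

## What

Data: an Euler system `c` for `T` over levels `L` (tree `IsEulerSystem`), the generator / Frobenius
data of THEOREM A at the bottom layer (`σ_ℓ, N_ℓ, Fr_ℓ` with `hσ`/`hcov`/`hinj`/`hFr`/`hram`), a
coefficient map `red : T ⟶ T′` with `T′` killed by `N_ℓ` and `P_ℓ(1)` (`hM₁`, `hM₂`) and
`(T′)^{U_r} = 0` (`h0`), Kolyvagin's class `κ ∈ H¹(K, T′)` (`res_{U_r} κ = D_r (red_* c_{⊥,r})`, `hκ`),
and a finite place `w` of `K` UNRAMIFIED in the level `U_r` (`hwU`) at which every class `c_{⊥,s}`,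
`s ⊆ r`, is UNRAMIFIED: `res_{I_𝔓} c_{⊥,s} = 0` for all `𝔓 ∣ w` (`hur`; for Kato's system this is the
`H¹(ℤ[ζ_m, 1/p], T)` clause of Kato (8.1.3), carried by the tree's `ZetaBody`).  CONCLUSION
(`exists_rep_apply_eq_red_invariant_of_unramified`): **`κ = [k]` for a cocycle `k` and there is
`v ∈ T′` such that `k − ∂v` VANISHES on the inertia group `I_{𝔓₀}` of the distinguished prime
`𝔓₀ ∣ w` and takes, on the decomposition group `D_{𝔓₀} = res(Γ_{K_w})`, values `red(t)` with
`t ∈ T^{I_{𝔓₀}}`.**  This is [MR04] Remark A.5's `loc_w κ_r ∈ H¹_{(𝓕_u)}(K_w, T′)` (the structure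
PROPAGATED from `H¹_ur(K_w, T)`), hence `⊆ 𝓕_can,w`, with NO hypothesis on the Kolyvagin primes —
contrast n1011's T-DER-BN E1 / T-DER-D4BN (`KolyvaginSystemOfEulerSystemBadPlaces`), which need
`p ∤ ord(w mod q)` for every `q ∈ r` (the soft descent; its obstruction group
`coker(N : E(L)[p^∞] → E(K_w)[p^∞])^∨` is non-zero exactly on the anomalous rows — w2-c3 memo §2).
Proof = U3 (`(g−1)·D_r c_r ∈ 𝔞_r • W`, `W` = classes unramified over `w`, `𝔞_r = ⟨N_ℓ, P_ℓ(1)⟩` —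
Rubin's Lemma 4.4.2 run BEFORE reduction) + unramified representatives (§1) + U2
(`exists_rep_sub_coboundary_eq_red_invariant`) at `D_{𝔓₀} ⊵ I_{𝔓₀}` (the tree's dictionary
`decompositionSubgroup_adicCompletionPrime_eq_range`): the descent is computed INSIDE `T^{I_w}`, where
no obstruction lives.  The packaging into `propagatedSelmerStructure` at finite coefficients is U4
(`exists_map_eq_oneCocycleClass_of_apply_eq_hom_invariant`) + the stable range
(`PropagatedConditionStableRange[Three]`) — the next file of this seat, not done here.  Nothing of
[MR04] §6.2's standing hypotheses (`ρ_{E,p^∞}` surjective, `p ≥ 5`) is imported — they belong to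
Prop. 6.2.6's application, not to Thm. 3.2.4 / Remark A.5.

References: B. Mazur, K. Rubin, *Kolyvagin systems*, Mem. AMS 799 (2004), Thm. 3.2.4, App. A
Prop. A.2, Remark A.5; K. Rubin, *Euler Systems* (2000), Lemma 4.4.2, Thm. 4.5.1; K. Kato,
Astérisque 295 (2004), (8.1.3); K. Büyükboduk, JNT 129 (2009) §3; J. Neukirch, *ANT*, II (9.6).
-/

noncomputable section

-- the cell's Theorems namespace `Summit.BirchSwinnertonDyer.BirchSwinnertonDyer.…` repeats the summit name by design (D-0017)
set_option linter.dupNamespace false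

open CategoryTheory Function Finset Polynomial Field IsDedekindDomain NumberField
open scoped NumberField Classical Pointwise
open Literature.NumberTheory.GaloisRepresentations
open Summit.BirchSwinnertonDyer.Rank1Residual.GaloisImage
open Summit.BirchSwinnertonDyer.Rank1Residual.GaloisImage.Derivative

universe u v w

namespace Summit.BirchSwinnertonDyer.BirchSwinnertonDyer.Theorems.KimAtThreeDeepUpperBadPlaceDescent

/-! ### §1 Unramified representatives; inertia is normalised by the decomposition group -/

section Reps

variable {R : Type v} [CommRing R] [TopologicalSpace R]
variable {G : Type u} [Group G] [TopologicalSpace G] [IsTopologicalGroup G]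
variable (X : TopRep.{u} R G) (U : Subgroup G)

/-- `res_I y = 0` for `y ∈ H¹(U, X)` iff-direction used here: some representative of `y` VANISHES on
`I` (subtract the coboundary `∂w` on `U`, continuous by the orbit continuity `hXc`). [folklore] -/
theorem exists_rep_apply_eq_zero_of_resLe_eq_zero (hXc : ∀ w : X, Continuous fun g : G => X.ρ g w)
    {I : Subgroup G} (hIU : I ≤ U) (y : continuousCohomology 1 (subgroupRep X U))
    (hy : resLe X hIU 1 y = 0) :
    ∃ φ : contOneCocycles (subgroupRep X U), oneCocycleClass _ φ = y ∧
      ∀ u (hu : u ∈ I), φ.1 ⟨u, hIU hu⟩ = 0 := by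
  obtain ⟨φ₀, rfl⟩ := oneCocycleClass_surjective _ y
  obtain ⟨w, hw⟩ := (resLe_oneCocycleClass_eq_zero_iff X U hIU φ₀).mp hy
  let δ : contOneCocycles (subgroupRep X U) :=
    ⟨⟨fun g => X.ρ (g : G) w - w, ((hXc w).comp continuous_subtype_val).sub continuous_const⟩,
      fun g h => by
        change X.ρ ((g * h : U) : G) w - w = (X.ρ (g : G) w - w) + X.ρ (g : G) (X.ρ (h : G) w - w)
        rw [Subgroup.coe_mul, map_sub, ρ_mul_apply]; abel⟩
  have hδ : oneCocycleClass _ δ = 0 :=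
    (oneCocycleClass_eq_zero_iff (subgroupRep X U) δ).mpr ⟨w, fun _ => rfl⟩
  refine ⟨φ₀ - δ, by rw [oneCocycleClass_sub, hδ, sub_zero], fun u hu => ?_⟩
  change φ₀.1 ⟨u, hIU hu⟩ - (X.ρ u w - w) = 0
  rw [hw u hu, sub_self]

end Reps

section Inertia

variable {K : Type u} [Field K] [NumberField K]

omit [NumberField K] in
/-- The inertia group `I_𝔓` of a prime `𝔓` of `\bar ℤ_K` is normalised by the decomposition group
`D_𝔓` (generic-universe copy of n1011-p10's `inv_mul_mul_mem_inertia_adicCompletionPrime`).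
[folklore] -/
theorem inv_mul_mul_mem_inertia_of_mem_decompositionSubgroup (𝔓 : Ideal (absIntegers (𝓞 K) K))
    {d : absoluteGaloisGroup K} (hd : d ∈ 𝔓.decompositionSubgroup (absoluteGaloisGroup K))
    {i : absoluteGaloisGroup K} (hi : i ∈ 𝔓.inertia (absoluteGaloisGroup K)) :
    d⁻¹ * i * d ∈ 𝔓.inertia (absoluteGaloisGroup K) := by
  rw [AddSubgroup.mem_inertia] at hi ⊢
  intro x
  have hd' := (Ideal.mem_decompositionSubgroup_iff).mp (Subgroup.inv_mem _ hd)
  have h2 : d⁻¹ • (i • (d • x) - d • x) ∈ d⁻¹ • 𝔓 :=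
    Ideal.smul_mem_pointwise_smul d⁻¹ _ 𝔓 (hi (d • x))
  rw [hd'] at h2
  have e : (d⁻¹ * i * d) • x - x = d⁻¹ • (i • (d • x) - d • x) := by
    rw [smul_sub, mul_smul, mul_smul, inv_smul_smul]
  rw [Submodule.mem_toAddSubgroup, e]
  exact h2

end Inertia

/-! ### §2 THEOREM B-u -/

section Main

variable {K : Type u} [Field K] [NumberField K] {ι : Type w} [Preorder ι] [OrderBot ι]
variable {A : Type v} [CommRing A] [TopologicalSpace A]
variable {M : Type u} [AddCommGroup M] [Module A M] [TopologicalSpace M] [IsTopologicalAddGroup M]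
  [ContinuousSMul A M] [Module.Free A M] [Module.Finite A M]
variable {L : EulerSystemLevels K ι} {T : GaloisRep K A M} {p : ℕ} [Fact p.Prime] [Algebra ℤ_[p] A]
variable {c : ∀ (i : ι) (r : L.Ideals), H1 T (L.level i r.1)}
variable {M' : Type u} [AddCommGroup M'] [Module A M'] [TopologicalSpace M'] [IsTopologicalAddGroup M']
  [ContinuousSMul A M'] {T' : GaloisRep K A M'}

/-- **THEOREM B-u** ([MR04] Remark A.5 at a place `w`; module docstring).  For an Euler system `c`,
THEOREM A's data at the bottom layer, `red : T ⟶ T′` with `T′` killed by `N_ℓ`, `P_ℓ(1)` and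
`(T′)^{U_r} = 0`, Kolyvagin's class `κ` (`res_{U_r} κ = D_r (red_* c_{⊥,r})`), and a finite place `w`
unramified in `U_r` at which every `c_{⊥,s}` (`s ⊆ r`) is unramified: `κ = [k]` with
`k − ∂v` vanishing on `I_{𝔓₀}` and `k(g) − ∂v(g) ∈ red(T^{I_{𝔓₀}})` for every `g` in the
decomposition group `res(Γ_{K_w})`, `𝔓₀ = adicCompletionPrime K w`.  NO condition on the primes of
`r` besides `w ∉ r` (through `hwU`). [cite: MazurRubin2004, App. A Remark A.5 (p. 81)]
[cite: Rubin2000, Lemma 4.4.2 and Thm. 4.5.1] -/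
theorem exists_rep_apply_eq_red_invariant_of_unramified (hc : IsEulerSystem L T p c)
    (red : T.toTopRep ⟶ T'.toTopRep) (r : L.Ideals)
    (σ : HeightOneSpectrum (𝓞 K) → absoluteGaloisGroup K) (N : HeightOneSpectrum (𝓞 K) → ℕ)
    (Fr : HeightOneSpectrum (𝓞 K) → absoluteGaloisGroup K)
    (hσ : ∀ ℓ ∈ r.1, ∀ q ∈ r.1, q ≠ ℓ → σ ℓ ∈ L.tameLevel q)
    (hcov : ∀ ℓ ∈ r.1, ∀ g : absoluteGaloisGroup K, ∃ j < N ℓ, (σ ℓ ^ j)⁻¹ * g ∈ L.tameLevel ℓ)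
    (hinj : ∀ ℓ ∈ r.1, ∀ j₁ < N ℓ, ∀ j₂ < N ℓ, (σ ℓ ^ j₁)⁻¹ * σ ℓ ^ j₂ ∈ L.tameLevel ℓ → j₁ = j₂)
    (hFr : ∀ ℓ ∈ r.1, IsArithFrobAtPlace K ℓ (Fr ℓ))
    (hram : ∀ ℓ ∈ r.1, ∀ s ⊆ r.1, ℓ ∉ s → ¬ SubgroupIsUnramifiedAt K (L.level ⊥ (insert ℓ s)) ℓ)
    (hM₁ : ∀ ℓ ∈ r.1, ∀ v : M', (N ℓ : A) • v = 0)
    (hM₂ : ∀ ℓ ∈ r.1, ∀ v : M',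
      (rubinEulerFactor T.toRepresentation (cyclotomicCharacterToUnits K p A) (Fr ℓ)).eval 1 • v = 0)
    (comm)
    (h0 : ∀ v : T'.toTopRep, (∀ u : L.level ⊥ r.1, T'.toTopRep.ρ (u : absoluteGaloisGroup K) v = v) →
      v = 0)
    (κ : continuousCohomology 1 T'.toTopRep)
    (hκ : resSubgroup T'.toTopRep (L.level ⊥ r.1) 1 κ =
        (r.1.noncommProd (fun ℓ => ∑ j ∈ range (N ℓ), (j : Module.End A (continuousCohomology 1
          (subgroupRep T'.toTopRep (L.level ⊥ r.1)))) *
          (conjMap T'.toTopRep (L.level ⊥ r.1) (σ ℓ) 1).hom.toLinearMap ^ j) comm)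
        (ContinuousCohomology.map (ContinuousMonoidHom.id _) (X := subgroupRep T.toTopRep (L.level ⊥ r.1))
          (Y := subgroupRep T'.toTopRep (L.level ⊥ r.1))
          ((TopRep.resFunctor (L.level ⊥ r.1).subtype).map red) 1 (c ⊥ r)))
    (w : HeightOneSpectrum (𝓞 K)) (hwU : SubgroupIsUnramifiedAt K (L.level ⊥ r.1) w)
    (hur : ∀ (s : Finset (HeightOneSpectrum (𝓞 K))) (hs : s ⊆ r.1) (𝔓 : Ideal (absIntegers (𝓞 K) K))
      (h𝔓 : 𝔓 ∈ w.primesAbove), resLe T.toTopRep (hwU 𝔓 h𝔓) 1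
        (resLe T.toTopRep (level_antitone L ⊥ hs) 1 (c ⊥ ⟨s, fun q hq => r.2 q (hs hq)⟩)) = 0) :
    ∃ (k : contOneCocycles T'.toTopRep) (v : T'.toTopRep), oneCocycleClass _ k = κ ∧
      (∀ u ∈ (adicCompletionPrime K w).inertia (absoluteGaloisGroup K),
        k.1 u - (T'.toTopRep.ρ u v - v) = 0) ∧
      ∀ g ∈ (absGaloisRestrict K (w.adicCompletion K)).toMonoidHom.range, ∃ t : T.toTopRep,
        (∀ u ∈ (adicCompletionPrime K w).inertia (absoluteGaloisGroup K), T.toTopRep.ρ u t = t) ∧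
        k.1 g - (T'.toTopRep.ρ g v - v) = red.hom t := by
  classical
  have htop : ∀ g : absoluteGaloisGroup K, g ∈ L.pLevel ⊥ := fun g => by
    rw [L.pLevel_bot]; exact Subgroup.mem_top g
  -- the inertia groups above `w`, their conjugation, the distinguished one
  have hconj : ∀ 𝔓 ∈ w.primesAbove, ∀ g : absoluteGaloisGroup K, ∃ 𝔓' ∈ w.primesAbove,
      ∀ s ∈ 𝔓.inertia (absoluteGaloisGroup K), g⁻¹ * s * g ∈ 𝔓'.inertia (absoluteGaloisGroup K) := by
    intro 𝔓 h𝔓 g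
    refine ⟨g⁻¹ • 𝔓, Derivative.smul_mem_primesAbove h𝔓 g⁻¹, fun s hs => ?_⟩
    have h := conj_mem_inertia_smul hs g⁻¹
    rwa [inv_inv] at h
  set 𝔓₀ : Ideal (absIntegers (𝓞 K) K) := adicCompletionPrime K w with h𝔓₀def
  have h𝔓₀ : 𝔓₀ ∈ w.primesAbove := adicCompletionPrime_mem_primesAbove K w
  -- the unramified submodule `W` of `H¹(U_r, T)`
  let W : Submodule A (H1 T (L.level ⊥ r.1)) :=
    { carrier := {y | ∀ 𝔓 (h𝔓 : 𝔓 ∈ w.primesAbove), resLe T.toTopRep (hwU 𝔓 h𝔓) 1 y = 0}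
      zero_mem' := fun 𝔓 h𝔓 => map_zero _
      add_mem' := fun {a b} ha hb 𝔓 h𝔓 => by
        change resLe T.toTopRep (hwU 𝔓 h𝔓) 1 (a + b) = 0
        rw [map_add, ha 𝔓 h𝔓, hb 𝔓 h𝔓, add_zero]
      smul_mem' := fun a {y} hy 𝔓 h𝔓 => by
        change resLe T.toTopRep (hwU 𝔓 h𝔓) 1 (a • y) = 0
        rw [map_smul, hy 𝔓 h𝔓, smul_zero] }
  have hWmem : ∀ {y}, y ∈ W ↔ ∀ 𝔓 (h𝔓 : 𝔓 ∈ w.primesAbove), resLe T.toTopRep (hwU 𝔓 h𝔓) 1 y = 0 :=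
    Iff.rfl
  have hW : ∀ g : absoluteGaloisGroup K, ∀ y ∈ W, conjMap T.toTopRep (L.level ⊥ r.1) g 1 y ∈ W := by
    intro g y hy
    rw [hWmem]
    intro 𝔓 h𝔓
    obtain ⟨𝔓', h𝔓', hI⟩ := hconj 𝔓 h𝔓 g
    exact resLe_conjMap_eq_zero T.toTopRep (L.level ⊥ r.1) g (hwU 𝔓 h𝔓) (hwU 𝔓' h𝔓') hI
      ((hWmem.mp hy) 𝔓' h𝔓')
  have hcW : ∀ (s : Finset (HeightOneSpectrum (𝓞 K))) (hs : s ⊆ r.1),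
      resLe T.toTopRep (level_antitone L ⊥ hs) 1 (c ⊥ ⟨s, fun q hq => r.2 q (hs hq)⟩) ∈ W :=
    fun s hs => hWmem.mpr fun 𝔓 h𝔓 => hur s hs 𝔓 h𝔓
  -- the Kolyvagin ideal `𝔞 = ⟨N_ℓ, P_ℓ(1) : ℓ ∈ r⟩`; it kills `T′`
  let S : Set A := {a | ∃ ℓ ∈ r.1, a = (N ℓ : A) ∨
    a = (rubinEulerFactor T.toRepresentation (cyclotomicCharacterToUnits K p A) (Fr ℓ)).eval 1}
  let 𝔞 : Ideal A := Ideal.span S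
  have hN : ∀ ℓ ∈ r.1, ((N ℓ : ℕ) : A) ∈ 𝔞 := fun ℓ hℓ => Ideal.subset_span ⟨ℓ, hℓ, Or.inl rfl⟩
  have hP : ∀ ℓ ∈ r.1,
      (rubinEulerFactor T.toRepresentation (cyclotomicCharacterToUnits K p A) (Fr ℓ)).eval 1 ∈ 𝔞 :=
    fun ℓ hℓ => Ideal.subset_span ⟨ℓ, hℓ, Or.inr rfl⟩
  have h𝔞 : ∀ a ∈ 𝔞, ∀ x : M', a • x = 0 := by
    intro a ha
    induction ha using Submodule.span_induction with
    | mem a hmem =>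
      obtain ⟨ℓ, hℓ, h | h⟩ := hmem
      · subst h; exact hM₁ ℓ hℓ
      · subst h; exact hM₂ ℓ hℓ
    | zero => intro x; exact zero_smul A x
    | add a b _ _ ha hb => intro x; rw [add_smul, ha x, hb x, add_zero]
    | smul t a _ ha => intro x; rw [smul_eq_mul, mul_smul, ha x, smul_zero]
  -- U3: `(g − 1) · D_r c_r ∈ 𝔞 • W` for every `g`
  have hmod := fun g : absoluteGaloisGroup K =>
    conjMap_deriv_sub_deriv_mem_smul hc ⊥ r σ N Fr (fun ℓ _ => htop (σ ℓ)) hσ hcov hinj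
      (fun ℓ _ => htop (Fr ℓ)) hFr hram 𝔞 hN hP W hW hcW
      (pairwise_commute_deriv (T' := T) ⊥ r.1 σ N) g (htop g)
  -- the T-level derivative `Y = D_r c_r` and `red_* Y = res κ`
  set Y : H1 T (L.level ⊥ r.1) :=
    (r.1.noncommProd (fun ℓ => ∑ j ∈ range (N ℓ), (j : Module.End A (H1 T (L.level ⊥ r.1))) *
      (conjMap T.toTopRep (L.level ⊥ r.1) (σ ℓ) 1).hom.toLinearMap ^ j)
      (pairwise_commute_deriv (T' := T) ⊥ r.1 σ N)) (c ⊥ r) with hYdef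
  have hκ' : resSubgroup T'.toTopRep (L.level ⊥ r.1) 1 κ =
      ContinuousCohomology.map (ContinuousMonoidHom.id _) (X := subgroupRep T.toTopRep (L.level ⊥ r.1))
        (Y := subgroupRep T'.toTopRep (L.level ⊥ r.1))
        ((TopRep.resFunctor (L.level ⊥ r.1).subtype).map red) 1 Y := by
    rw [hκ, hYdef, map_red_deriv_comm]
  -- `Y` is unramified at `𝔓₀`
  have hYW : Y ∈ W := by
    rw [hWmem]
    intro 𝔓 h𝔓
    set 𝓘 : Set (Subgroup (absoluteGaloisGroup K)) :=
      {I | ∃ 𝔓' ∈ w.primesAbove, I = 𝔓'.inertia (absoluteGaloisGroup K)} with h𝓘_def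
    have h𝓘U : ∀ I ∈ 𝓘, I ≤ L.level ⊥ r.1 := by
      rintro I ⟨𝔓', h𝔓', rfl⟩; exact hwU 𝔓' h𝔓'
    have h𝓘conj : ∀ I ∈ 𝓘, ∀ g : absoluteGaloisGroup K, ∃ I' ∈ 𝓘, ∀ s ∈ I, g⁻¹ * s * g ∈ I' := by
      rintro I ⟨𝔓', h𝔓', rfl⟩ g
      obtain ⟨𝔓'', h𝔓'', hI⟩ := hconj 𝔓' h𝔓' g
      exact ⟨_, ⟨𝔓'', h𝔓'', rfl⟩, hI⟩
    have hcr : ∀ I (hI : I ∈ 𝓘), resLe T.toTopRep (h𝓘U I hI) 1 (c ⊥ r) = 0 := by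
      rintro I ⟨𝔓', h𝔓', rfl⟩
      have h := hur r.1 subset_rfl 𝔓' h𝔓'
      rwa [resLe_refl_apply] at h
    have h := forall_resLe_noncommProd_deriv_eq_zero T.toTopRep (L.level ⊥ r.1) 𝓘 h𝓘U h𝓘conj
      r.1 σ N (pairwise_commute_deriv (T' := T) ⊥ r.1 σ N) hcr
      (𝔓.inertia (absoluteGaloisGroup K)) ⟨𝔓, h𝔓, rfl⟩
    rw [← hYdef] at h
    exact h
  have hY : resLe T.toTopRep (hwU 𝔓₀ h𝔓₀) 1 Y = 0 := (hWmem.mp hYW) 𝔓₀ h𝔓₀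
  -- orbit continuity of `T`
  have hTc : ∀ x : T.toTopRep, Continuous fun g : absoluteGaloisGroup K => T.toTopRep.ρ g x :=
    fun x => T.continuous_apply_left x
  -- the witnesses: every class of `𝔞 • W` has a representative vanishing on `I_{𝔓₀}` killed by `red`
  have hrep : ∀ y ∈ 𝔞 • W, ∃ ρ : contOneCocycles (subgroupRep T.toTopRep (L.level ⊥ r.1)),
      oneCocycleClass _ ρ = y ∧
      (∀ u (hu : u ∈ 𝔓₀.inertia (absoluteGaloisGroup K)), ρ.1 ⟨u, hwU 𝔓₀ h𝔓₀ hu⟩ = 0) ∧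
      (∀ n : L.level ⊥ r.1, red.hom (ρ.1 n) = 0) := by
    intro y hy
    refine Submodule.smul_induction_on (p := fun y => ∃ ρ : contOneCocycles
        (subgroupRep T.toTopRep (L.level ⊥ r.1)), oneCocycleClass _ ρ = y ∧
        (∀ u (hu : u ∈ 𝔓₀.inertia (absoluteGaloisGroup K)), ρ.1 ⟨u, hwU 𝔓₀ h𝔓₀ hu⟩ = 0) ∧
        (∀ n : L.level ⊥ r.1, red.hom (ρ.1 n) = 0)) hy (fun a ha y₀ hy₀ => ?_)
      (fun y₁ y₂ h₁ h₂ => ?_)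
    · obtain ⟨φ, hφ, hφI⟩ := exists_rep_apply_eq_zero_of_resLe_eq_zero T.toTopRep (L.level ⊥ r.1)
        hTc (hwU 𝔓₀ h𝔓₀) y₀ ((hWmem.mp hy₀) 𝔓₀ h𝔓₀)
      refine ⟨a • φ, by rw [oneCocycleClass_smul, hφ], fun u hu => ?_, fun n => ?_⟩
      · change a • φ.1 ⟨u, hwU 𝔓₀ h𝔓₀ hu⟩ = 0
        rw [hφI u hu, smul_zero]
      · change red.hom (a • φ.1 n) = 0
        rw [map_smul, h𝔞 a ha]
    · obtain ⟨ρ₁, h₁c, h₁I, h₁r⟩ := h₁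
      obtain ⟨ρ₂, h₂c, h₂I, h₂r⟩ := h₂
      refine ⟨ρ₁ + ρ₂, by rw [oneCocycleClass_add, h₁c, h₂c], fun u hu => ?_, fun n => ?_⟩
      · change ρ₁.1 _ + ρ₂.1 _ = 0
        rw [h₁I u hu, h₂I u hu, add_zero]
      · change red.hom (ρ₁.1 n + ρ₂.1 n) = 0
        rw [map_add, h₁r n, h₂r n, add_zero]
  -- the decomposition group normalises `I_{𝔓₀}`
  have hI : ∀ g ∈ (absGaloisRestrict K (w.adicCompletion K)).toMonoidHom.range,
      ∀ u ∈ 𝔓₀.inertia (absoluteGaloisGroup K), g⁻¹ * u * g ∈ 𝔓₀.inertia (absoluteGaloisGroup K) := by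
    intro g hg u hu
    rw [← decompositionSubgroup_adicCompletionPrime_eq_range] at hg
    exact inv_mul_mul_mem_inertia_of_mem_decompositionSubgroup 𝔓₀ hg hu
  -- U2
  have hwit : ∀ g ∈ (absGaloisRestrict K (w.adicCompletion K)).toMonoidHom.range,
      ∃ ρ : contOneCocycles (subgroupRep T.toTopRep (L.level ⊥ r.1)),
        conjMap T.toTopRep (L.level ⊥ r.1) g 1 Y - Y = oneCocycleClass _ ρ ∧
        (∀ u (hu : u ∈ 𝔓₀.inertia (absoluteGaloisGroup K)), ρ.1 ⟨u, hwU 𝔓₀ h𝔓₀ hu⟩ = 0) ∧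
        (∀ n : L.level ⊥ r.1, red.hom (ρ.1 n) = 0) := by
    intro g _
    obtain ⟨ρ, hρ, hρI, hρr⟩ := hrep _ (hmod g)
    exact ⟨ρ, hρ.symm, hρI, hρr⟩
  exact exists_rep_sub_coboundary_eq_red_invariant red (L.level ⊥ r.1)
    (absGaloisRestrict K (w.adicCompletion K)).toMonoidHom.range (𝔓₀.inertia (absoluteGaloisGroup K))
    (hwU 𝔓₀ h𝔓₀) hI h0 κ Y hκ' hY hwit

end Main

end Summit.BirchSwinnertonDyer.BirchSwinnertonDyer.Theorems.KimAtThreeDeepUpperBadPlaceDescent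

end
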